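import Literature.NumberTheory.Rogawski1990.TypeThreeCubicTorusAlgebra
import Literature.NumberTheory.Automorphic.CMLocalNonsplitBorelTransport
import HarnessLib

/-!
# The cubic torus of `U(Φ₃)(L⁺_v)` at a non-split finite place — a Cartan subgroup of TYPE (3) exists, its regular elements
# are unmatched and accumulate at `1` ([Rogawski1990] §3.6; Lemma 12.7.2 (proof) p. 194)

Topic `NumberTheory/Rogawski1990`; namespace `Literature.NumberTheory.Rogawski1990.TypeThreeTorus`.  THEOREMS ONLY (no definition, no
instance, no notation, no named fact, no `sorry`); kernel lane `--supports stmt-HodgeConjecture-24833`.  Sequel of ★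
`TypeThreeCubicTorusAlgebra` (the generic algebra), instantiated in the ONE-PLACE MODEL `U(σ_w, Φ₃)(L_w)` of the quasi-split local group
`Gqs L v = U(Φ₃)(L⁺_v)` (★ `UnitaryGroup.localNonsplitEquiv`) at a finite place `v` of `L⁺` that does not split in the CM field `L`
(`w ∣ v` the place above, `σ_w = galAdicCompletionMap c hw` the conjugation of `L_w ⊃ L⁺_v`).

WHY (cell `pub/hodgecm-mathlib`, crux H413, line LH6 «StCharTSPaydown» ED. 12): the (S-𝔇) package organ `stub_EllipticPackage` binds
`∃ 𝔇 d T par, …` with `T : Subgroup (Gqs L v)` «a Cartan subgroup of type (3)» carrying the clauses (T3) «its regular elements are (elliptic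
and) UNMATCHED: `charpoly γ` has no root `z₀₀`, `z ∈ U(1)(L⁺_v)`» and (GERM-3) (a germ expansion along `𝓝[T ∩ G^reg] 1`, non-vacuous only if
regular elements of `T` accumulate at `1`).  LH6-p01's census `CENSUS-DAT-HALF.v1` rows 8–11: «no assembled list of Cartan subgroups of
`U(Φ₃)(L⁺_v)` (types (0)–(3) of §3.6)» — type (1) is ★ `cmBorelTriple`, type (2) the ★ `TypeTwo*` kit; this file supplies type (3).

THE CONSTRUCTION.  `a := ϖ·σ_w(ϖ) ∈ L_w` for a uniformiser `ϖ` (so `σ_w a = a` and `ord_w a = 2`, hence `a` is NOT A CUBE and `x³ − a` is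
irreducible over `L_w`, ★ `irreducible_X_pow_three_sub_C`); `C = !![0,0,a; 1,0,0; 0,1,0]`; the torus is
`T_w := U(σ_w, Φ₃) ⊓ Z(C) = {M(p,q,r) = !![p, a r, a q; q, p, a r; r, q, p] | M(σp,σq,σr)·M(p,q,r) = 1} ≅ ker(N : (L_w·K)^× → K^×)`, `K = L⁺_v(a^{1/3})`
(★ `form_cubicMat_eq_iff`, ★ `commute_companion_iff`), and `T := T_w` pulled back to `Gqs L v`.
* §1 the one-place data: `σ_w` is an involution, an anti-fixed `δ ≠ 0`, a uniformiser, `a` not a cube.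
* §2 the torus in `U(σ_w, Φ₃)(L_w)`: abelian; (T3) a REGULAR element has a characteristic polynomial WITHOUT ROOTS in `L_w` (★
  `not_isRoot_charpoly_of_separable`); a non-regular element is scalar; the norm-one curve `t ↦ y(t)`, `t = aⁿδ`, consists of regular
  elements (★ `separable_charpoly_cubicMat_iff`, `2t ≠ 0`) and tends to `1` — regular elements ACCUMULATE at `1`.
* §3 transport to `U(Φ₃)(L⁺_v)` along ★ `localNonsplitEquiv` (a homeomorphic isomorphism; `charpoly (e γ) = (charpoly γ).map ev_w`, and
  `ev_w : L ⊗ L⁺_v → L_w` is a ring isomorphism at a non-split place, so `IsRegularElt γ ↔ charpoly (e γ)` separable): the HEAD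
  `exists_typeThree_cartan` (carrier `↥(UnitaryGroup.«local» L c 3 Φ₃ v)`), its (T3)-token corollary `exists_typeThree_cartan_unmatched`
  (no root of the form `z₀₀`, `z ∈ U(1)(L⁺_v)` — the organ's spelling — under the organ's non-split binder `hns`) and the same on the
  organ's carrier `Gqs L v` VERBATIM, `exists_typeThree_cartan_unmatched_gqs` (★ `cmDatum_Local` is `rfl`).
NOT HERE: compactness of `T` (norm-one elements of the sextic field are units), the conjugacy classification of §3.6, (GERM-3) itself.
HONEST LABEL: count-neutral infrastructure for the (S-𝔇) DAT road; HC_CM is proved only modulo the cell's printed citations (2 remaining named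
inputs hLiu418 24832, h413 24833) until rung 0 closes; this file is unconditional.

## References
* [Rogawski1990] J. D. Rogawski, *Automorphic Representations of Unitary Groups in Three Variables*, Ann. of Math. Stud. 123 (1990), §3.6
  p. 31, §12.5 p. 184, Lemma 12.7.2 (proof) p. 194.
* [PlatonovRapinchuk1994] V. Platonov, A. Rapinchuk, *Algebraic Groups and Number Theory* (1994), §2.3, §6.4 Prop. 6.15 (elliptic tori).
* [CasselsFrohlichANT1967] J. W. S. Cassels, A. Fröhlich (eds.), *Algebraic Number Theory* (1967), Ch. II §10, Ch. VII §1.1.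
-/

set_option autoImplicit false

noncomputable section

open scoped MatrixGroups Matrix Topology
open Matrix Polynomial Filter NumberField IsDedekindDomain
open Literature.NumberTheory.Automorphic Literature.NumberTheory.Automorphic.UnitaryGroup

namespace Literature.NumberTheory.Rogawski1990.TypeThreeTorus

section OnePlace

variable (L : Type) [Field L] [NumberField L] [IsCMField L] {v : HeightOneSpectrum (𝓞 ↥(maximalRealSubfield L))}
  (w : PlacesOver L v) (hw : IsCMField.complexConj L • w.1 = w.1)

/-! ## §1 The one-place data at a non-split place: `σ_w`, an anti-fixed `δ`, a uniformiser, `a = ϖ·σϖ` not a cube -/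

/-- `c² = 1` for the complex conjugation of a CM field (order two). [cite: Rogawski1990, §1.9 p. 8] -/
private theorem complexConj_mul_complexConj' : IsCMField.complexConj L * IsCMField.complexConj L = 1 := by
  rw [← pow_two, ← IsCMField.orderOf_complexConj L, pow_orderOf_eq_one]

/-- **`σ_w` is an involution of `L_w`** at a `c`-fixed place (`c² = 1` and the cocycle law of the Galois transport).
[cite: CasselsFrohlichANT1967, Ch. VII §1.1] -/
theorem galAdicCompletionMap_cm_involutive (y : w.1.adicCompletion L) :
    galAdicCompletionMap (L := L) (IsCMField.complexConj L) hw (galAdicCompletionMap (L := L) (IsCMField.complexConj L) hw y) = y := by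
  rw [galAdicCompletionMap_galAdicCompletionMap L (IsCMField.complexConj L) (IsCMField.complexConj L) hw hw,
    galAdicCompletionMap_congr_left L (complexConj_mul_complexConj' L) _ (one_smul _ w.1), galAdicCompletionMap_one]

/-- **An anti-fixed unit of `L_w`**: there is `δ ≠ 0` in `L_w` with `σ_w δ = −δ` (`δ = e − σ_w e` for any `e ∈ L` moved by `c`; `L → L_w` is
injective). [cite: CasselsFrohlichANT1967, Ch. VII §1.1] -/
theorem exists_antifixed :
    ∃ δ : w.1.adicCompletion L, δ ≠ 0 ∧ galAdicCompletionMap (L := L) (IsCMField.complexConj L) hw δ = -δ := by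
  obtain ⟨e, he⟩ : ∃ e : L, IsCMField.complexConj L e ≠ e := by
    by_contra h
    push Not at h
    exact IsCMField.complexConj_ne_one L (AlgEquiv.ext h)
  refine ⟨(e : w.1.adicCompletion L) - galAdicCompletionMap (L := L) (IsCMField.complexConj L) hw (e : w.1.adicCompletion L), ?_, ?_⟩
  · intro h0
    rw [sub_eq_zero, galAdicCompletionMap_coe] at h0
    apply he
    have hinj : Function.Injective (algebraMap L (w.1.adicCompletion L)) := (algebraMap L (w.1.adicCompletion L)).injective
    exact (hinj h0).symm
  · rw [map_sub, galAdicCompletionMap_cm_involutive, neg_sub]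

/-- **A uniformiser of `L_w` with `σ_w`-stable order**: there is `ϖ ∈ L_w` with `v_w(ϖ) = v_w(σ_w ϖ) = exp(−1)`. [cite: CasselsFrohlichANT1967, Ch. II §10] -/
theorem exists_uniformizer :
    ∃ ϖ : w.1.adicCompletion L, Valued.v ϖ = WithZero.exp (-1 : ℤ) ∧
      Valued.v (galAdicCompletionMap (L := L) (IsCMField.complexConj L) hw ϖ) = WithZero.exp (-1 : ℤ) := by
  obtain ⟨π, hπ⟩ := HeightOneSpectrum.valuation_exists_uniformizer L w.1
  refine ⟨(π : w.1.adicCompletion L), ?_, ?_⟩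
  · rw [HeightOneSpectrum.valuedAdicCompletion_eq_valuation', hπ]
  · rw [valued_galAdicCompletionMap, HeightOneSpectrum.valuedAdicCompletion_eq_valuation', hπ]

/-- **`a = ϖ·σ_w ϖ` is `σ_w`-fixed, non-zero, of order `2`, hence NOT A CUBE in `L_w`** (`3 ∤ 2`). [cite: Rogawski1990, §3.6 p. 31] -/
theorem exists_fixed_not_cube :
    ∃ a : w.1.adicCompletion L, a ≠ 0 ∧ galAdicCompletionMap (L := L) (IsCMField.complexConj L) hw a = a ∧
      Valued.v a < 1 ∧ ∀ b : w.1.adicCompletion L, b ^ 3 ≠ a := by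
  obtain ⟨ϖ, hϖ, hσϖ⟩ := exists_uniformizer L w hw
  refine ⟨ϖ * galAdicCompletionMap (L := L) (IsCMField.complexConj L) hw ϖ, ?_, ?_, ?_, ?_⟩
  · intro h0
    have := congrArg Valued.v h0
    rw [map_mul, map_zero, hϖ, hσϖ, ← WithZero.exp_add] at this
    exact WithZero.exp_ne_zero this
  · rw [map_mul, galAdicCompletionMap_cm_involutive, mul_comm]
  · rw [map_mul, hϖ, hσϖ, ← WithZero.exp_add, ← WithZero.exp_zero, WithZero.exp_lt_exp]
    norm_num
  · intro b hb
    have h := congrArg (fun x => WithZero.log (Valued.v x)) hb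
    simp only [map_pow, map_mul, hϖ, hσϖ, WithZero.log_pow] at h
    rw [← WithZero.exp_add, WithZero.log_exp, nsmul_eq_mul] at h
    push_cast at h
    omega

omit [IsCMField L] in
/-- The form of the one-place model of `U(Φ₃)` is the literal `Φ₃ = !![0,0,1; 0,1,0; 1,0,0]` over `L_w`. [cite: Rogawski1990, §1.9 p. 8] -/
theorem placeForm_qsForm_eq :
    placeForm (Rogawski1990.qsForm L) w.1 = !![(0 : w.1.adicCompletion L), 0, 1; 0, 1, 0; 1, 0, 0] := by
  rw [placeForm, Rogawski1990.qsForm, antidiagOne_eq_over, StdForm.over_map, ← antidiagOne_eq_over, antidiag_of_eq]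

end OnePlace

/-! ## §2 The cubic torus inside `U(σ, Φ₃)(K)` over a field: abelian, (T3), scalars, and regular elements near `1` -/

section Field

variable {K : Type*} [Field K]

/-- **The cubic torus is ABELIAN**: two matrices commuting with the cyclic `C = !![0,0,a;1,0,0;0,1,0]` commute with each other (both lie in
`K[C]`, ★ `commute_companion_iff`, ★ `cubicMat_comm`). [cite: Rogawski1990, §3.6 p. 31] -/
theorem mul_comm_of_commute_companion (a : K) (g g' : Matrix (Fin 3) (Fin 3) K)
    (hg : g * !![(0 : K), 0, a; 1, 0, 0; 0, 1, 0] = !![(0 : K), 0, a; 1, 0, 0; 0, 1, 0] * g)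
    (hg' : g' * !![(0 : K), 0, a; 1, 0, 0; 0, 1, 0] = !![(0 : K), 0, a; 1, 0, 0; 0, 1, 0] * g') : g * g' = g' * g := by
  rw [(commute_companion_iff a g).mp hg, (commute_companion_iff a g').mp hg']
  exact cubicMat_comm a _ _ _ _ _ _

/-- **(T3) for the cubic torus** (`x³ − a` irreducible over `K`): a matrix commuting with `C` whose characteristic polynomial is separable
(a REGULAR element of the torus) has NO eigenvalue in `K`. [cite: Rogawski1990, §12.7 p. 194; §3.6 p. 31] -/
theorem not_isRoot_charpoly_of_commute_companion {a : K} (hirr : Irreducible (X ^ 3 - Polynomial.C a : K[X]))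
    (g : Matrix (Fin 3) (Fin 3) K) (hg : g * !![(0 : K), 0, a; 1, 0, 0; 0, 1, 0] = !![(0 : K), 0, a; 1, 0, 0; 0, 1, 0] * g)
    (hsep : g.charpoly.Separable) (μ : K) : ¬ g.charpoly.IsRoot μ := by
  have h := (commute_companion_iff a g).mp hg
  rw [h] at hsep ⊢
  exact not_isRoot_charpoly_of_separable hirr hsep μ

/-- A NON-regular element of the cubic torus is a SCALAR (`K` perfect, `x³ − a` irreducible). [cite: Rogawski1990, §3.6 p. 31] -/
theorem exists_eq_smul_one_of_commute_companion [PerfectField K] {a : K} (hirr : Irreducible (X ^ 3 - Polynomial.C a : K[X]))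
    (g : Matrix (Fin 3) (Fin 3) K) (hg : g * !![(0 : K), 0, a; 1, 0, 0; 0, 1, 0] = !![(0 : K), 0, a; 1, 0, 0; 0, 1, 0] * g)
    (hns : ¬ g.charpoly.Separable) : ∃ e : K, g = e • (1 : Matrix (Fin 3) (Fin 3) K) := by
  have h := (commute_companion_iff a g).mp hg
  rw [h] at hns
  obtain ⟨h1, h2⟩ := eq_zero_of_not_separable_charpoly hirr hns
  refine ⟨g 0 0, ?_⟩
  rw [h, h1, h2, one_fin_three]
  ext i j; fin_cases i <;> fin_cases j <;> simp

end Field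

section Normed

variable {K : Type*} [NormedField K] [PerfectField K]

/-- **Regular elements of the cubic torus ACCUMULATE AT `1`** (`K` a perfect normed field, `σ` continuous, `σ a = a`, `0 < ‖a‖ < 1`,
`x³ − a` irreducible, `σ δ = −δ ≠ 0`, `2 ≠ 0`): every neighbourhood of `1` in `U(σ, Φ₃)(K)` contains an element commuting with `C` whose
characteristic polynomial is separable — the norm-one curve `y(t) = (1 + t x)(1 − t x)⁻¹`, `t = aⁿ δ → 0` (★ `cubicMat_curve_mul_eq_one`,
★ `separable_charpoly_cubicMat_iff`). [cite: Rogawski1990, §3.6 p. 31; §12.7 p. 194] -/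
theorem exists_regular_commute_companion_mem_nhds_one (σ : K →+* K) (hσc : Continuous σ)
    {a δ : K} (ha : σ a = a) (ha0 : a ≠ 0) (ha1 : ‖a‖ < 1) (hirr : Irreducible (X ^ 3 - Polynomial.C a : K[X]))
    (hδ : σ δ = -δ) (hδ0 : δ ≠ 0) (h2 : (2 : K) ≠ 0) (J : Matrix (Fin 3) (Fin 3) K) (hJ : J = !![(0 : K), 0, 1; 0, 1, 0; 1, 0, 0])
    (V : Set ↥(unitaryGroupOfForm σ J)) (hV : V ∈ 𝓝 (1 : ↥(unitaryGroupOfForm σ J))) :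
    ∃ γ ∈ V, ((γ : GL (Fin 3) K) : Matrix (Fin 3) (Fin 3) K) * !![(0 : K), 0, a; 1, 0, 0; 0, 1, 0] =
        !![(0 : K), 0, a; 1, 0, 0; 0, 1, 0] * ((γ : GL (Fin 3) K) : Matrix (Fin 3) (Fin 3) K) ∧
      (((γ : GL (Fin 3) K) : Matrix (Fin 3) (Fin 3) K).charpoly).Separable := by
  subst hJ
  -- the parameter `t_n = aⁿ δ → 0`, anti-fixed
  set t : ℕ → K := fun n => a ^ n * δ with ht_def
  have hσt : ∀ n, σ (t n) = -t n := fun n => by simp only [ht_def, map_mul, map_pow, ha, hδ, mul_neg]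
  have ht0 : ∀ n, t n ≠ 0 := fun n => mul_ne_zero (pow_ne_zero _ ha0) hδ0
  have htends : Tendsto t atTop (𝓝 0) := by
    simpa using (tendsto_pow_atTop_nhds_zero_of_norm_lt_one ha1).mul_const δ
  -- `s_n = a t_n³ → 0`, eventually `1 ± s_n ≠ 0`
  set s : ℕ → K := fun n => a * t n ^ 3 with hs_def
  have hstends : Tendsto s atTop (𝓝 0) := by
    simpa using (htends.pow 3).const_mul a
  have hev : ∀ᶠ n in atTop, ‖s n‖ < 1 := by
    have := hstends.norm
    simp only [norm_zero] at this
    exact this.eventually (gt_mem_nhds zero_lt_one)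
  have hgood : ∀ᶠ n in atTop, 1 - s n ≠ 0 ∧ 1 + s n ≠ 0 := by
    filter_upwards [hev] with n hn
    constructor
    · intro h0
      have : s n = 1 := by linear_combination (exp := 1) -h0
      rw [this, norm_one] at hn
      exact lt_irrefl _ hn
    · intro h0
      have : s n = -1 := by linear_combination (exp := 1) h0
      rw [this, norm_neg, norm_one] at hn
      exact lt_irrefl _ hn
  -- the coordinates of `y(t_n)` and their limits
  set d : ℕ → K := fun n => (1 - s n)⁻¹ with hd_def
  set p : ℕ → K := fun n => (1 + s n) * d n with hp_def
  set q : ℕ → K := fun n => 2 * t n * d n with hq_def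
  set r : ℕ → K := fun n => 2 * t n ^ 2 * d n with hr_def
  have hdtends : Tendsto d atTop (𝓝 1) := by
    have := (tendsto_const_nhds.sub hstends).inv₀ (by simp : (1 : K) - 0 ≠ 0)
    simpa using this
  have hptends : Tendsto p atTop (𝓝 1) := by
    simpa using (tendsto_const_nhds.add hstends).mul hdtends
  have hqtends : Tendsto q atTop (𝓝 0) := by
    simpa using (htends.const_mul 2).mul hdtends
  have hrtends : Tendsto r atTop (𝓝 0) := by
    simpa using ((htends.pow 2).const_mul 2).mul hdtends
  have hσ1 : Tendsto σ (𝓝 1) (𝓝 1) := by simpa using hσc.tendsto 1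
  have hσ0 : Tendsto σ (𝓝 0) (𝓝 0) := by simpa using hσc.tendsto 0
  -- the matrices `M_n = y(t_n)` and `N_n = σ M_n = M_n⁻¹`
  set M : ℕ → Matrix (Fin 3) (Fin 3) K := fun n => !![p n, a * r n, a * q n; q n, p n, a * r n; r n, q n, p n] with hM_def
  set N : ℕ → Matrix (Fin 3) (Fin 3) K :=
    fun n => !![σ (p n), a * σ (r n), a * σ (q n); σ (q n), σ (p n), a * σ (r n); σ (r n), σ (q n), σ (p n)] with hN_def
  have hMtends : Tendsto M atTop (𝓝 1) := by
    rw [hM_def, one_fin_three]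
    refine tendsto_pi_nhds.2 fun i => tendsto_pi_nhds.2 fun j => ?_
    fin_cases i <;> fin_cases j
    · simpa using hptends
    · simpa using hrtends.const_mul a
    · simpa using hqtends.const_mul a
    · simpa using hqtends
    · simpa using hptends
    · simpa using hrtends.const_mul a
    · simpa using hrtends
    · simpa using hqtends
    · simpa using hptends
  have hNtends : Tendsto N atTop (𝓝 1) := by
    rw [hN_def, one_fin_three]
    refine tendsto_pi_nhds.2 fun i => tendsto_pi_nhds.2 fun j => ?_
    fin_cases i <;> fin_cases j
    · simpa [Function.comp_def] using hσ1.comp hptends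
    · simpa [Function.comp_def] using (hσ0.comp hrtends).const_mul a
    · simpa [Function.comp_def] using (hσ0.comp hqtends).const_mul a
    · simpa [Function.comp_def] using hσ0.comp hqtends
    · simpa [Function.comp_def] using hσ1.comp hptends
    · simpa [Function.comp_def] using (hσ0.comp hrtends).const_mul a
    · simpa [Function.comp_def] using hσ0.comp hrtends
    · simpa [Function.comp_def] using hσ0.comp hqtends
    · simpa [Function.comp_def] using hσ1.comp hptends
  -- neighbourhoods of `1` in `U(σ,Φ₃)` come from `M₃(K) × M₃(K)ᵐᵒᵖ` through `g ↦ (g, g⁻¹)`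
  rw [nhds_subtype, Filter.mem_comap] at hV
  obtain ⟨V₁, hV₁, hVV₁⟩ := hV
  rw [Units.isEmbedding_embedProduct.isInducing.nhds_eq_comap, Filter.mem_comap] at hV₁
  obtain ⟨W, hW, hWV₁⟩ := hV₁
  have hW1 : W ∈ 𝓝 ((1 : Matrix (Fin 3) (Fin 3) K), MulOpposite.op (1 : Matrix (Fin 3) (Fin 3) K)) := by
    simpa using hW
  have hpair : Tendsto (fun n => (M n, MulOpposite.op (N n))) atTop
      (𝓝 ((1 : Matrix (Fin 3) (Fin 3) K), MulOpposite.op (1 : Matrix (Fin 3) (Fin 3) K))) :=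
    hMtends.prodMk_nhds (MulOpposite.continuous_op.tendsto 1 |>.comp hNtends)
  obtain ⟨n, ⟨hgn1, hgn2⟩, hnW⟩ := (hgood.and (hpair.eventually hW1)).exists
  -- the unit `u_n = y(t_n)` and its membership
  have hNM : N n * M n = 1 := by
    simp only [hN_def, hM_def, hp_def, hq_def, hr_def, hd_def, hs_def]
    exact cubicMat_curve_mul_eq_one σ ha (hσt n) hgn1
  have hMN : M n * N n = 1 := (cubicMat_comm a (p n) (q n) (r n) (σ (p n)) (σ (q n)) (σ (r n))).trans hNM
  let u : GL (Fin 3) K := ⟨M n, N n, hMN, hNM⟩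
  have hu : u ∈ unitaryGroupOfForm σ !![(0 : K), 0, 1; 0, 1, 0; 1, 0, 0] := by
    show ((M n).map σ)ᵀ * !![(0 : K), 0, 1; 0, 1, 0; 1, 0, 0] * M n = !![(0 : K), 0, 1; 0, 1, 0; 1, 0, 0]
    rw [hM_def, form_cubicMat_eq_iff σ ha]
    exact hNM
  refine ⟨⟨u, hu⟩, ?_, ?_, ?_⟩
  · apply hVV₁
    show u ∈ V₁
    apply hWV₁
    show Units.embedProduct _ u ∈ W
    exact hnW
  · exact cubicMat_mul_companion a (p n) (q n) (r n)
  · show (M n).charpoly.Separable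
    rw [hM_def, separable_charpoly_cubicMat_iff hirr]
    rintro ⟨hq0, -⟩
    apply ht0 n
    have hd0 : d n ≠ 0 := inv_ne_zero hgn1
    simpa [hq_def, h2, hd0] using hq0

end Normed



/-! ## §3 Transport to `U(Φ₃)(L⁺_v)` along the one-place model ★ `localNonsplitEquiv`

All statements below are typed on the carrier `↥(UnitaryGroup.«local» L c 3 Φ₃ v)`, which IS `Gqs L v = (cmDatum L 3 Φ₃).Local v` (★ `cmDatum_Local`,
`rfl`) — the organ's `T : Subgroup (Gqs L v)` is inhabited by the `T` below through that definitional equality. -/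

section CM

variable (L : Type) [Field L] [NumberField L] [IsCMField L] {v : HeightOneSpectrum (𝓞 ↥(maximalRealSubfield L))}
  (w : PlacesOver L v) (hw : IsCMField.complexConj L • w.1 = w.1)

/-- `charpoly (e γ) = (charpoly γ).map ev_w` for the one-place model `e` (its matrix is the `w`-component, ★ `coe_localNonsplitEquiv_apply`).
[cite: PlatonovRapinchuk1994, §5.1] -/
theorem charpoly_localNonsplitEquiv (γ : ↥(«local» L (IsCMField.complexConj L) 3 (Rogawski1990.qsForm L) v)) :
    (((localNonsplitEquiv (IsCMField.complexConj L) (Rogawski1990.qsForm L) (IsCMField.complexConj_ne_one L) w hw γ : ↥(unitaryGroupOfForm (galAdicCompletionMap (L := L) (IsCMField.complexConj L) hw) (placeForm (Rogawski1990.qsForm L) w.1))) :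
            GL (Fin 3) (w.1.adicCompletion L)) : Matrix (Fin 3) (Fin 3) (w.1.adicCompletion L)).charpoly =
      (((γ : GL (Fin 3) (LocalRing L v)) : Matrix (Fin 3) (Fin 3) (LocalRing L v)).charpoly).map (Pi.evalRingHom (fun w' : PlacesOver L v => w'.1.adicCompletion L) w) := by
  have h : (((localNonsplitEquiv (IsCMField.complexConj L) (Rogawski1990.qsForm L) (IsCMField.complexConj_ne_one L) w hw γ : ↥(unitaryGroupOfForm (galAdicCompletionMap (L := L) (IsCMField.complexConj L) hw) (placeForm (Rogawski1990.qsForm L) w.1))) :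
            GL (Fin 3) (w.1.adicCompletion L)) : Matrix (Fin 3) (Fin 3) (w.1.adicCompletion L)) =
      ((γ : GL (Fin 3) (LocalRing L v)) : Matrix (Fin 3) (Fin 3) (LocalRing L v)).map (Pi.evalRingHom (fun w' : PlacesOver L v => w'.1.adicCompletion L) w) := rfl
  rw [h, Matrix.charpoly_map]

include hw in
/-- At a non-split place the `w`-evaluation `L ⊗ L⁺_v = ∏_{w′ ∣ v} L_{w′} → L_w` is a ring ISOMORPHISM (one place above `v`): bijectivity.
[cite: PlatonovRapinchuk1994, §5.1] -/
theorem bijective_evalRingHom_of_nonsplit :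
    Function.Bijective (Pi.evalRingHom (fun w' : PlacesOver L v => w'.1.adicCompletion L) w) := by
  haveI : Subsingleton (PlacesOver L v) :=
    PlacesOver.subsingleton_of_smul_eq (IsCMField.complexConj L) (IsCMField.complexConj_ne_one L) w hw
  constructor
  · intro x y hxy
    funext w'
    obtain rfl : w' = w := Subsingleton.elim _ _
    exact hxy
  · intro x
    refine ⟨fun w' => cast (congrArg (fun w'' : PlacesOver L v => w''.1.adicCompletion L) (Subsingleton.elim w w')) x, ?_⟩
    exact cast_eq (congrArg (fun w'' : PlacesOver L v => w''.1.adicCompletion L) (Subsingleton.elim w w)) x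

/-- **Regularity is the same on both sides of the one-place model**: `IsRegularElt γ ↔ charpoly (e γ)` separable (`→` by `Polynomial.Separable.map`;
`←` because `ev_w` is a ring isomorphism at a non-split place). [cite: Rogawski1990, §3.1 p. 19] [cite: PlatonovRapinchuk1994, §5.1] -/
theorem isRegularElt_iff_separable_localNonsplitEquiv (γ : ↥(«local» L (IsCMField.complexConj L) 3 (Rogawski1990.qsForm L) v)) :
    IsRegularElt (γ : GL (Fin 3) (LocalRing L v)) ↔ (((localNonsplitEquiv (IsCMField.complexConj L) (Rogawski1990.qsForm L) (IsCMField.complexConj_ne_one L) w hw γ : ↥(unitaryGroupOfForm (galAdicCompletionMap (L := L) (IsCMField.complexConj L) hw) (placeForm (Rogawski1990.qsForm L) w.1))) :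
            GL (Fin 3) (w.1.adicCompletion L)) : Matrix (Fin 3) (Fin 3) (w.1.adicCompletion L)).charpoly.Separable := by
  rw [charpoly_localNonsplitEquiv L w hw γ, isRegularElt_iff]
  constructor
  · exact fun h => h.map
  · intro h
    set ev : LocalRing L v →+* w.1.adicCompletion L := Pi.evalRingHom (fun w' : PlacesOver L v => w'.1.adicCompletion L) w with hev
    set P : (LocalRing L v)[X] := ((γ : GL (Fin 3) (LocalRing L v)) : Matrix (Fin 3) (Fin 3) (LocalRing L v)).charpoly with hP
    let φ : LocalRing L v ≃+* w.1.adicCompletion L := RingEquiv.ofBijective ev (bijective_evalRingHom_of_nonsplit L w hw)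
    have hφ : (φ : LocalRing L v →+* w.1.adicCompletion L) = ev := RingHom.ext fun _ => rfl
    have hp : P = (P.map ev).map (φ.symm : w.1.adicCompletion L →+* LocalRing L v) := by
      rw [← hφ, Polynomial.map_map, RingEquiv.symm_comp, Polynomial.map_id]
    rw [hp]
    exact h.map

/-- **THE CUBIC TORUS ATTACHED TO A GIVEN `a`** (`σ_w a = a`, `a ≠ 0`, `v_w a < 1`, `a` not a cube): the parametrised form of the HEAD
below — `T := U(σ_w, Φ₃) ⊓ Z(C_a)` pulled back to `U(Φ₃)(L⁺_v)`, with (i) the membership criterion, (ii) abelian, (iii) (T3), (iv) scalars,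
(v) accumulation (so that sequels can name THE SAME `T` from `a`). [cite: Rogawski1990, §3.6 p. 31; §12.7 p. 194] -/
theorem exists_typeThree_cartan_of_elt (a : w.1.adicCompletion L)
    (hσa : galAdicCompletionMap (L := L) (IsCMField.complexConj L) hw a = a) (ha0 : a ≠ 0) (ha1 : Valued.v a < 1)
    (hcube : ∀ b : w.1.adicCompletion L, b ^ 3 ≠ a) :
    ∃ T : Subgroup ↥(«local» L (IsCMField.complexConj L) 3 (Rogawski1990.qsForm L) v),
      (∀ γ : ↥(«local» L (IsCMField.complexConj L) 3 (Rogawski1990.qsForm L) v), γ ∈ T ↔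
        (((localNonsplitEquiv (IsCMField.complexConj L) (Rogawski1990.qsForm L) (IsCMField.complexConj_ne_one L) w hw γ : ↥(unitaryGroupOfForm (galAdicCompletionMap (L := L) (IsCMField.complexConj L) hw) (placeForm (Rogawski1990.qsForm L) w.1))) :
            GL (Fin 3) (w.1.adicCompletion L)) : Matrix (Fin 3) (Fin 3) (w.1.adicCompletion L)) * !![(0 : w.1.adicCompletion L), 0, a; 1, 0, 0; 0, 1, 0] =
          !![(0 : w.1.adicCompletion L), 0, a; 1, 0, 0; 0, 1, 0] * (((localNonsplitEquiv (IsCMField.complexConj L) (Rogawski1990.qsForm L) (IsCMField.complexConj_ne_one L) w hw γ : ↥(unitaryGroupOfForm (galAdicCompletionMap (L := L) (IsCMField.complexConj L) hw) (placeForm (Rogawski1990.qsForm L) w.1))) :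
            GL (Fin 3) (w.1.adicCompletion L)) : Matrix (Fin 3) (Fin 3) (w.1.adicCompletion L))) ∧
      (∀ γ ∈ T, ∀ γ' ∈ T, γ * γ' = γ' * γ) ∧
      (∀ γ ∈ T, IsRegularElt (γ : GL (Fin 3) (LocalRing L v)) → ∀ μ : LocalRing L v, ¬ (((γ : GL (Fin 3) (LocalRing L v)) : Matrix (Fin 3) (Fin 3) (LocalRing L v)).charpoly).IsRoot μ) ∧
      (∀ γ ∈ T, ¬ IsRegularElt (γ : GL (Fin 3) (LocalRing L v)) →
        ∃ z : w.1.adicCompletion L, (((localNonsplitEquiv (IsCMField.complexConj L) (Rogawski1990.qsForm L) (IsCMField.complexConj_ne_one L) w hw γ : ↥(unitaryGroupOfForm (galAdicCompletionMap (L := L) (IsCMField.complexConj L) hw) (placeForm (Rogawski1990.qsForm L) w.1))) :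
            GL (Fin 3) (w.1.adicCompletion L)) : Matrix (Fin 3) (Fin 3) (w.1.adicCompletion L)) = z • (1 : Matrix (Fin 3) (Fin 3) (w.1.adicCompletion L))) ∧
      (∀ U ∈ 𝓝 (1 : ↥(«local» L (IsCMField.complexConj L) 3 (Rogawski1990.qsForm L) v)), ∃ γ ∈ T, γ ∈ U ∧ IsRegularElt (γ : GL (Fin 3) (LocalRing L v))) := by
  have hirr : Irreducible (X ^ 3 - Polynomial.C a : (w.1.adicCompletion L)[X]) := irreducible_X_pow_three_sub_C hcube
  obtain ⟨δ, hδ0, hσδ⟩ := exists_antifixed L w hw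
  -- abbreviations
  set σ := galAdicCompletionMap (L := L) (IsCMField.complexConj L) hw with hσ_def
  set e := localNonsplitEquiv (IsCMField.complexConj L) (Rogawski1990.qsForm L) (IsCMField.complexConj_ne_one L) w hw with he_def
  set Cm : Matrix (Fin 3) (Fin 3) (w.1.adicCompletion L) := !![(0 : w.1.adicCompletion L), 0, a; 1, 0, 0; 0, 1, 0] with hCm_def
  -- the torus: the centraliser of the (invertible) companion matrix inside the one-place model, pulled back along `e`
  let Cu : GL (Fin 3) (w.1.adicCompletion L) := Matrix.GeneralLinearGroup.mkOfDetNeZero Cm (by rw [hCm_def, det_companion]; exact ha0)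
  have hCu : ((Cu : GL (Fin 3) (w.1.adicCompletion L)) : Matrix (Fin 3) (Fin 3) (w.1.adicCompletion L)) = Cm := rfl
  let TE : Subgroup ↥(unitaryGroupOfForm (galAdicCompletionMap (L := L) (IsCMField.complexConj L) hw) (placeForm (Rogawski1990.qsForm L) w.1)) := (Subgroup.centralizer ({Cu} : Set (GL (Fin 3) (w.1.adicCompletion L)))).subgroupOf _
  let T : Subgroup ↥(«local» L (IsCMField.complexConj L) 3 (Rogawski1990.qsForm L) v) := TE.comap e.toMulEquiv.toMonoidHom
  have hmemTE : ∀ g : ↥(unitaryGroupOfForm (galAdicCompletionMap (L := L) (IsCMField.complexConj L) hw) (placeForm (Rogawski1990.qsForm L) w.1)), g ∈ TE ↔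
      ((g : GL (Fin 3) (w.1.adicCompletion L)) : Matrix (Fin 3) (Fin 3) (w.1.adicCompletion L)) * Cm =
        Cm * ((g : GL (Fin 3) (w.1.adicCompletion L)) : Matrix (Fin 3) (Fin 3) (w.1.adicCompletion L)) := by
    intro g
    simp only [TE, Subgroup.mem_subgroupOf, Subgroup.mem_centralizer_iff, Set.mem_singleton_iff, forall_eq]
    rw [Units.ext_iff, Units.val_mul, Units.val_mul, hCu, eq_comm]
  have hmemT : ∀ γ : ↥(«local» L (IsCMField.complexConj L) 3 (Rogawski1990.qsForm L) v), γ ∈ T ↔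
      (((e γ : ↥(unitaryGroupOfForm (galAdicCompletionMap (L := L) (IsCMField.complexConj L) hw) (placeForm (Rogawski1990.qsForm L) w.1))) : GL (Fin 3) (w.1.adicCompletion L)) : Matrix (Fin 3) (Fin 3) (w.1.adicCompletion L)) * Cm =
        Cm * (((e γ : ↥(unitaryGroupOfForm (galAdicCompletionMap (L := L) (IsCMField.complexConj L) hw) (placeForm (Rogawski1990.qsForm L) w.1))) : GL (Fin 3) (w.1.adicCompletion L)) : Matrix (Fin 3) (Fin 3) (w.1.adicCompletion L)) := fun γ => by
    rw [← hmemTE]; exact Subgroup.mem_comap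
  refine ⟨T, hmemT, ?_, ?_, ?_, ?_⟩
  · -- (ii) abelian: the one-place images commute (★ `mul_comm_of_commute_companion`) and `e` is injective
    intro γ hγ γ' hγ'
    have hE := mul_comm_of_commute_companion a _ _ ((hmemT γ).mp hγ) ((hmemT γ').mp hγ')
    apply e.injective
    rw [map_mul, map_mul]
    exact Subtype.ext (Units.ext hE)
  · -- (iii) (T3)
    intro γ hγ hreg μ hμ
    have hsep := (isRegularElt_iff_separable_localNonsplitEquiv L w hw γ).mp hreg
    have hμ' := hμ.map (f := Pi.evalRingHom (fun w' : PlacesOver L v => w'.1.adicCompletion L) w)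
    rw [← charpoly_localNonsplitEquiv L w hw γ] at hμ'
    exact not_isRoot_charpoly_of_commute_companion hirr _ ((hmemT γ).mp hγ) hsep _ hμ'
  · -- (iv) non-regular ⇒ scalar
    intro γ hγ hnreg
    have hns : ¬ (((e γ : ↥(unitaryGroupOfForm (galAdicCompletionMap (L := L) (IsCMField.complexConj L) hw) (placeForm (Rogawski1990.qsForm L) w.1))) : GL (Fin 3) (w.1.adicCompletion L)) : Matrix (Fin 3) (Fin 3) (w.1.adicCompletion L)).charpoly.Separable :=
      fun h => hnreg ((isRegularElt_iff_separable_localNonsplitEquiv L w hw γ).mpr h)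
    exact exists_eq_smul_one_of_commute_companion hirr _ ((hmemT γ).mp hγ) hns
  · -- (v) regular elements accumulate at 1: pull the one-place curve back along the homeomorphism `e`
    intro U hU
    have hc : Continuous (fun x => e.symm x) := e.symm.continuous
    have ht : Tendsto (fun x => e.symm x) (𝓝 1) (𝓝 (1 : ↥(«local» L (IsCMField.complexConj L) 3 (Rogawski1990.qsForm L) v))) := by
      simpa only [map_one] using hc.tendsto 1
    have hV : (fun x => e.symm x) ⁻¹' U ∈ 𝓝 (1 : ↥(unitaryGroupOfForm (galAdicCompletionMap (L := L) (IsCMField.complexConj L) hw) (placeForm (Rogawski1990.qsForm L) w.1))) := Filter.mem_map.1 (ht hU)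
    have ha1' : ‖a‖ < 1 := Valued.toNormedField.norm_lt_one_iff.mpr ha1
    obtain ⟨g, hgV, hgC, hgsep⟩ := exists_regular_commute_companion_mem_nhds_one σ (continuous_galAdicCompletionMap L _ hw)
      hσa ha0 ha1' hirr hσδ hδ0 two_ne_zero (placeForm (Rogawski1990.qsForm L) w.1) (placeForm_qsForm_eq L w) _ hV
    refine ⟨e.symm g, ?_, hgV, ?_⟩
    · rw [hmemT, ContinuousMulEquiv.apply_symm_apply]
      exact hgC
    · rw [isRegularElt_iff_separable_localNonsplitEquiv L w hw, ← he_def, ContinuousMulEquiv.apply_symm_apply]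
      exact hgsep

/-- **HEAD. A CARTAN SUBGROUP OF TYPE (3) OF `U(Φ₃)(L⁺_v)` AT A NON-SPLIT PLACE, WITH (T3) AND ACCUMULATION** ([Rogawski1990] §3.6;
Lemma 12.7.2 (proof) p. 194 «let `T` be a Cartan subgroup of type (3)»).  There are `a ∈ L_w` (`σ_w`-fixed, non-zero, not a cube —
so `K = L⁺_v(a^{1/3})` is a cubic field and `L_w·K = L_w[x]/(x³ − a)` a field) and a subgroup `T ≤ U(Φ₃)(L⁺_v)` (carrier
`↥(UnitaryGroup.«local» L c 3 Φ₃ v) = Gqs L v`, ★ `cmDatum_Local`) such that: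
(i) `γ ∈ T` iff the one-place image of `γ` commutes with the companion matrix `C = !![0,0,a; 1,0,0; 0,1,0]` (so `T ≅ ker N_{L_wK/K}`, the
norm-one torus of type (3), ★ `form_cubicMat_eq_iff` ∕ ★ `exists_eq_cubicMat_of_commute_of_form`); (ii) `T` is ABELIAN; (iii) **(T3)** a
REGULAR `γ ∈ T` (★ `IsRegularElt`: separable characteristic polynomial) has a characteristic polynomial with NO ROOT in `L ⊗ L⁺_v` — it is
not stably conjugate to any element of `H = U(2) × U(1)`; (iv) a non-regular `γ ∈ T` is a scalar (in the one-place model); (v) every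
neighbourhood of `1` contains a regular element of `T` (non-vacuity of germ expansions along `𝓝[T ∩ G^reg] 1`).
[cite: Rogawski1990, §3.6 p. 31; §12.7 p. 194] [cite: PlatonovRapinchuk1994, §6.4 Prop. 6.15] -/
theorem exists_typeThree_cartan :
    ∃ (a : w.1.adicCompletion L) (T : Subgroup ↥(«local» L (IsCMField.complexConj L) 3 (Rogawski1990.qsForm L) v)),
      galAdicCompletionMap (L := L) (IsCMField.complexConj L) hw a = a ∧ a ≠ 0 ∧ (∀ b : w.1.adicCompletion L, b ^ 3 ≠ a) ∧
      (∀ γ : ↥(«local» L (IsCMField.complexConj L) 3 (Rogawski1990.qsForm L) v), γ ∈ T ↔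
        (((localNonsplitEquiv (IsCMField.complexConj L) (Rogawski1990.qsForm L) (IsCMField.complexConj_ne_one L) w hw γ : ↥(unitaryGroupOfForm (galAdicCompletionMap (L := L) (IsCMField.complexConj L) hw) (placeForm (Rogawski1990.qsForm L) w.1))) :
            GL (Fin 3) (w.1.adicCompletion L)) : Matrix (Fin 3) (Fin 3) (w.1.adicCompletion L)) * !![(0 : w.1.adicCompletion L), 0, a; 1, 0, 0; 0, 1, 0] =
          !![(0 : w.1.adicCompletion L), 0, a; 1, 0, 0; 0, 1, 0] * (((localNonsplitEquiv (IsCMField.complexConj L) (Rogawski1990.qsForm L) (IsCMField.complexConj_ne_one L) w hw γ : ↥(unitaryGroupOfForm (galAdicCompletionMap (L := L) (IsCMField.complexConj L) hw) (placeForm (Rogawski1990.qsForm L) w.1))) :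
            GL (Fin 3) (w.1.adicCompletion L)) : Matrix (Fin 3) (Fin 3) (w.1.adicCompletion L))) ∧
      (∀ γ ∈ T, ∀ γ' ∈ T, γ * γ' = γ' * γ) ∧
      (∀ γ ∈ T, IsRegularElt (γ : GL (Fin 3) (LocalRing L v)) → ∀ μ : LocalRing L v, ¬ (((γ : GL (Fin 3) (LocalRing L v)) : Matrix (Fin 3) (Fin 3) (LocalRing L v)).charpoly).IsRoot μ) ∧
      (∀ γ ∈ T, ¬ IsRegularElt (γ : GL (Fin 3) (LocalRing L v)) →
        ∃ z : w.1.adicCompletion L, (((localNonsplitEquiv (IsCMField.complexConj L) (Rogawski1990.qsForm L) (IsCMField.complexConj_ne_one L) w hw γ : ↥(unitaryGroupOfForm (galAdicCompletionMap (L := L) (IsCMField.complexConj L) hw) (placeForm (Rogawski1990.qsForm L) w.1))) :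
            GL (Fin 3) (w.1.adicCompletion L)) : Matrix (Fin 3) (Fin 3) (w.1.adicCompletion L)) = z • (1 : Matrix (Fin 3) (Fin 3) (w.1.adicCompletion L))) ∧
      (∀ U ∈ 𝓝 (1 : ↥(«local» L (IsCMField.complexConj L) 3 (Rogawski1990.qsForm L) v)), ∃ γ ∈ T, γ ∈ U ∧ IsRegularElt (γ : GL (Fin 3) (LocalRing L v))) := by
  obtain ⟨a, ha0, hσa, ha1, hcube⟩ := exists_fixed_not_cube L w hw
  obtain ⟨T, hT⟩ := exists_typeThree_cartan_of_elt L w hw a hσa ha0 ha1 hcube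
  exact ⟨a, T, hσa, ha0, hcube, hT⟩

/-- **(T3) IN THE ORGAN'S SPELLING** — the second conjunct of the (T3) clause of the (S-𝔇) package `stub_EllipticPackage` (LH6 leaf ED. 12) for
THIS `T`, under the organ's own non-split binder `hns`: for a regular `γ ∈ T` and every `z ∈ U(1)(L⁺_v) = (cmDatum L 1 Φ₁).Local v`,
`charpoly γ` does NOT have the root `z₀₀` (a type-(3) regular element is matched by no `γ_H ∈ H = U(2) × U(1)`, whose stable class always
carries an eigenvalue in `E¹`); together with «`T` abelian», the root-free form «no root in `L ⊗ L⁺_v` at all» and «regular elements of `T`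
accumulate at `1`».  Carrier `↥(UnitaryGroup.«local» L c 3 Φ₃ v) = Gqs L v` (★ `cmDatum_Local`, `rfl`). [cite: Rogawski1990, §12.7 p. 194; §3.6 p. 31] -/
theorem exists_typeThree_cartan_unmatched (v : HeightOneSpectrum (𝓞 ↥(maximalRealSubfield L)))
    (hns : ∀ w : PlacesOver L v, IsCMField.complexConj L • w.1 = w.1) :
    ∃ T : Subgroup ↥(«local» L (IsCMField.complexConj L) 3 (Rogawski1990.qsForm L) v),
      (∀ γ ∈ T, ∀ γ' ∈ T, γ * γ' = γ' * γ) ∧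
      (∀ γ ∈ T, IsRegularElt (γ : GL (Fin 3) (LocalRing L v)) → ∀ μ : LocalRing L v, ¬ (((γ : GL (Fin 3) (LocalRing L v)) : Matrix (Fin 3) (Fin 3) (LocalRing L v)).charpoly).IsRoot μ) ∧
      (∀ γ ∈ T, IsRegularElt (γ : GL (Fin 3) (LocalRing L v)) →
        ∀ z : (UnitaryGroup.cmDatum L 1 (Matrix.of fun i j : Fin 1 => if i.val + j.val + 1 = 1 then (1 : L) else 0)).Local v,
          ¬ (((γ : GL (Fin 3) (LocalRing L v)) : Matrix (Fin 3) (Fin 3) (LocalRing L v)).charpoly).IsRoot ((((z.val : GL (Fin 1) (LocalRing L v)) : Matrix (Fin 1) (Fin 1) (LocalRing L v))) 0 0)) ∧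
      (∀ U ∈ 𝓝 (1 : ↥(«local» L (IsCMField.complexConj L) 3 (Rogawski1990.qsForm L) v)), ∃ γ ∈ T, γ ∈ U ∧ IsRegularElt (γ : GL (Fin 3) (LocalRing L v))) := by
  obtain ⟨w⟩ := (inferInstance : Nonempty (PlacesOver L v))
  obtain ⟨a, T, -, -, -, -, hcomm, hT3, -, hacc⟩ := exists_typeThree_cartan L w (hns w)
  exact ⟨T, hcomm, hT3, fun γ hγ hreg z => hT3 γ hγ hreg _, hacc⟩

/-- **The same four conclusions on the organ's carrier `Gqs L v = (cmDatum L 3 Φ₃).Local v`** (★ `cmDatum_Local` is `rfl`; this is the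
(T3)-shaped export a consumer of `stub_EllipticPackage`'s binder `T : Subgroup (Gqs L v)` cites by name). [cite: Rogawski1990, §12.7 p. 194; §3.6 p. 31] -/
theorem exists_typeThree_cartan_unmatched_gqs (v : HeightOneSpectrum (𝓞 ↥(maximalRealSubfield L)))
    (hns : ∀ w : PlacesOver L v, IsCMField.complexConj L • w.1 = w.1) :
    ∃ T : Subgroup (Gqs L v),
      (∀ γ ∈ T, ∀ γ' ∈ T, γ * γ' = γ' * γ) ∧
      (∀ γ ∈ T, IsRegularElt (γ.val : GL (Fin 3) (LocalRing L v)) →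
        ∀ μ : LocalRing L v, ¬ ((((γ.val : GL (Fin 3) (LocalRing L v)) : Matrix (Fin 3) (Fin 3) (LocalRing L v))).charpoly).IsRoot μ) ∧
      (∀ γ ∈ T, IsRegularElt (γ.val : GL (Fin 3) (LocalRing L v)) →
        ∀ z : (UnitaryGroup.cmDatum L 1 (Matrix.of fun i j : Fin 1 => if i.val + j.val + 1 = 1 then (1 : L) else 0)).Local v,
          ¬ ((((γ.val : GL (Fin 3) (LocalRing L v)) : Matrix (Fin 3) (Fin 3) (LocalRing L v))).charpoly).IsRoot
            ((((z.val : GL (Fin 1) (LocalRing L v)) : Matrix (Fin 1) (Fin 1) (LocalRing L v))) 0 0)) ∧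
      (∀ U ∈ 𝓝 (1 : Gqs L v), ∃ γ ∈ T, γ ∈ U ∧ IsRegularElt (γ.val : GL (Fin 3) (LocalRing L v))) :=
  exists_typeThree_cartan_unmatched L v hns

end CM

end Literature.NumberTheory.Rogawski1990.TypeThreeTorus

end
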